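/-
Copyright: the b2b-balaban T⁴-continuum CRUX team, row NE7b OWNER lineage `t4-ne7b-p1` (gen 105). Project licence.
-/
import Summits.QuantumFields.BalabanUV.T4Continuum.Spine.NE7b.GaussianBlockDecoupling

/-!
# DECOUPLING WITH COUPLED BLOCKS, FIBREWISE: the far block's characteristic functions and self-coupling NEVER enter the restricted
# moment; what enters is ONLY the uniformity of the SHIFTED near-block moment over far small-field configurations — residual (R1′)
# (row NE7b, node U5c; kernel theorems of real analysis)

Cell `pub-balaban`, sub-cell `t4`, spine estimate NE7b (`T4WeightBudget.RelWeightBound`; the cell's OWN estimate — NOT PRINTED in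
[Bałaban 1983–89], NOT PROVED).  Crux-route work under `Spine/NE7b/` by the row's OWNER; NOTHING of Bałaban's is named or asserted;
no `T4Continuum/Support` leaf typed; zero `sorry`.

WHY.  `…NE7b.GaussianBlockDecoupling` settled residual (R1) (refuter κ-ne7bref-g65-1) in the EXACTLY decoupled model `S = S₁ ⊕ S₂`.
A fluctuation covariance is not block-diagonal: the near variables `x₁` (a neighbourhood of the pinned region) couple to the far ones
`x₂` through `S₁₂`.  THIS FILE shows what survives WITH the coupling, by disintegrating along the far variables (Fubini): for
`S = [[S₁₁, S₁₂], [S₁₂ᵀ, S₂₂]]`, `Q = Q₁ ⊕ 0` and `F(x) = F₁(x₁)·F₂(x₂)`, on EVERY fibre `{x₂ fixed}` the far factor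
`F₂(x₂)·e^{−x₂ᵀS₂₂x₂}` multiplies numerator and denominator alike, so
**if the SHIFTED near-block restricted moment is bounded uniformly over the far configurations in the support of `F₂`** —
`∫ F₁ e^{x₁ᵀQ₁x₁} e^{−(x₁ᵀS₁₁x₁ + 2x₁ᵀS₁₂x₂)} dx₁ ≤ C · ∫ F₁ e^{−(x₁ᵀS₁₁x₁ + 2x₁ᵀS₁₂x₂)} dx₁` whenever `F₂(x₂) ≠ 0` —
**then the whole restricted moment is `≤ C`**: the far block's characteristic function (however many conditions, whatever the volume)
and its self-coupling `S₂₂` do not enter AT ALL.  The displayed hypothesis is residual **(R1′)**: uniformity of a near-block moment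
under the exterior SHIFT `S₁₂x₂` — the `n`-variable form of `…LocalConditionalStability.gaussian_partial_moment_shift` (leaf-01's
`GaussianRankLocalMomentShift` supplies such bounds with an explicit shift price); print controls the shift by the finite range of the
fluctuation covariance and the small-field bound on `x₂` near the region ([Balaban1989LargeFieldI] §1) — NOT here.

WHAT IS PROVED ([folklore]; Mathlib Fubini `integral_prod_symm` on `(n₁ → ℝ) × (n₂ → ℝ)` transported along `sumPiEquivProdPi`):
* §1 **`integral_le_of_fibrewise`** (product measures: fibrewise domination `∫ A(·,y) ≤ C·∫ B(·,y)` for all `y` integrates to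
  `∫ A ≤ C·∫ B`), **`integral_le_of_fibrewise_sum`** (the same on `(n₁ ⊕ n₂) → ℝ`, fibres `x₂ ↦ Sum.elim x₁ x₂`).
* §2 `qf_fromBlocks_coupled` (`xᵀ[[S₁₁,S₁₂],[S₁₂ᵀ,S₂₂]]x = x₁ᵀS₁₁x₁ + 2·x₁ᵀS₁₂x₂ + x₂ᵀS₂₂x₂`), and
  **`restrictedMoment_le_of_shifted_fibres`** (the statement above, with the integrability of the two full integrands displayed).

NOT HERE (honest): the shift control (finite range + maximum principle ∕ random-walk expansion), the non-Gaussian remainder (R2),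
anything of Bałaban's.  NE7b NOT PRINTED ∕ NOT PROVED; spine PROVED 0∕9; rung (B)+1 on a FINITE torus — NOT infinite volume, NOT the
mass gap, NOT Clay.
HONEST DEPENDENCY: continuum YM on T⁴ ⇐ BetaPertH ∧ nine spine estimates (0/9 proved); BetaPertH ⇐ (D1) ∧ (D4) ∧ CAP+tail.
-/

set_option autoImplicit false

open Matrix Finset MeasureTheory Real
open Summit.QuantumFields.BalabanUV.T4Continuum.NE7b.GaussianBlockDecoupling

namespace Summit.QuantumFields.BalabanUV.T4Continuum.NE7b.GaussianFibrewiseDecoupling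

/-! ## §1 Fibrewise domination integrates -/

/-- **FIBREWISE DOMINATION INTEGRATES** (product measures): if on every fibre `∫ A(x, y) dμ(x) ≤ C · ∫ B(x, y) dμ(x)` and both
`A`, `B` are integrable for `μ ⊗ ν`, then `∫ A ≤ C · ∫ B`. [folklore] -/
theorem integral_le_of_fibrewise {α β : Type*} [MeasurableSpace α] [MeasurableSpace β] (μ : Measure α) (ν : Measure β)
    [SFinite μ] [SFinite ν] {A B : α × β → ℝ} (hA : Integrable A (μ.prod ν)) (hB : Integrable B (μ.prod ν)) {C : ℝ}
    (hfib : ∀ y, ∫ x, A (x, y) ∂μ ≤ C * ∫ x, B (x, y) ∂μ) :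
    ∫ z, A z ∂(μ.prod ν) ≤ C * ∫ z, B z ∂(μ.prod ν) := by
  rw [integral_prod_symm A hA, integral_prod_symm B hB, ← integral_const_mul]
  exact integral_mono hA.integral_prod_right (hB.integral_prod_right.const_mul C) hfib

variable {n₁ n₂ : Type} [Fintype n₁] [Fintype n₂]

omit [Fintype n₁] [Fintype n₂] in
/-- The inverse of `sumPiEquivProdPi` glues the two blocks: it IS `Sum.elim`. [folklore] -/
theorem sumPiEquivProdPi_symm_apply' (p : (n₁ → ℝ) × (n₂ → ℝ)) :
    (MeasurableEquiv.sumPiEquivProdPi fun _ : n₁ ⊕ n₂ => ℝ).symm p = Sum.elim p.1 p.2 := by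
  funext i
  cases i <;> rfl

/-- **FIBREWISE DOMINATION INTEGRATES on `(n₁ ⊕ n₂) → ℝ`** (fibres = far variables fixed): if both integrands are integrable and
`∫ A(Sum.elim x₁ x₂) dx₁ ≤ C · ∫ B(Sum.elim x₁ x₂) dx₁` for every `x₂`, then `∫ A ≤ C · ∫ B`. [folklore] -/
theorem integral_le_of_fibrewise_sum {A B : (n₁ ⊕ n₂ → ℝ) → ℝ} (hA : Integrable A) (hB : Integrable B) {C : ℝ}
    (hfib : ∀ x₂ : n₂ → ℝ, ∫ x₁ : n₁ → ℝ, A (Sum.elim x₁ x₂) ≤ C * ∫ x₁ : n₁ → ℝ, B (Sum.elim x₁ x₂)) :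
    ∫ x, A x ≤ C * ∫ x, B x := by
  have hmp := volume_measurePreserving_sumPiEquivProdPi_symm (fun _ : n₁ ⊕ n₂ => ℝ)
  have hemb := (MeasurableEquiv.sumPiEquivProdPi fun _ : n₁ ⊕ n₂ => ℝ).symm.measurableEmbedding
  rw [← hmp.integral_comp hemb, ← hmp.integral_comp hemb]
  have hA' := (hmp.integrable_comp_emb hemb).2 hA
  have hB' := (hmp.integrable_comp_emb hemb).2 hB
  rw [MeasureTheory.Measure.volume_eq_prod] at hA' hB' ⊢
  refine integral_le_of_fibrewise volume volume hA' hB' fun x₂ => ?_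
  simp only [Function.comp_def, sumPiEquivProdPi_symm_apply'] at hfib ⊢
  exact hfib x₂

/-! ## §2 The restricted moment with COUPLED blocks: only the shifted near-block moment enters -/

/-- The quadratic form of a symmetric two-block matrix: `xᵀ[[S₁₁,S₁₂],[S₁₂ᵀ,S₂₂]]x = x₁ᵀS₁₁x₁ + 2·x₁ᵀS₁₂x₂ + x₂ᵀS₂₂x₂`.
[folklore] -/
theorem qf_fromBlocks_coupled (S₁₁ : Matrix n₁ n₁ ℝ) (S₁₂ : Matrix n₁ n₂ ℝ) (S₂₂ : Matrix n₂ n₂ ℝ)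
    (x₁ : n₁ → ℝ) (x₂ : n₂ → ℝ) :
    Sum.elim x₁ x₂ ⬝ᵥ (Matrix.fromBlocks S₁₁ S₁₂ S₁₂ᵀ S₂₂ *ᵥ Sum.elim x₁ x₂) =
      x₁ ⬝ᵥ (S₁₁ *ᵥ x₁) + 2 * (x₁ ⬝ᵥ (S₁₂ *ᵥ x₂)) + x₂ ⬝ᵥ (S₂₂ *ᵥ x₂) := by
  rw [fromBlocks_mulVec, Sum.elim_comp_inl, Sum.elim_comp_inr, sumElim_dotProduct_sumElim, dotProduct_add, dotProduct_add,
    mulVec_transpose, dotProduct_comm x₂ (x₁ ᵥ* S₁₂), ← dotProduct_mulVec]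
  ring

/-- **THE RESTRICTED MOMENT WITH COUPLED BLOCKS IS CONTROLLED BY THE SHIFTED NEAR-BLOCK MOMENT ALONE.**  Blocks `x₁` (near) and `x₂`
(far) coupled through `S₁₂`; sacrificed form `Q₁ ⊕ 0`; restriction `F₁(x₁)·F₂(x₂)` with `F₂ ≥ 0`.  If on every far configuration in
the support of `F₂` the SHIFTED near-block restricted moment is dominated —
`∫ F₁ e^{x₁ᵀQ₁x₁} e^{−(x₁ᵀS₁₁x₁ + 2x₁ᵀS₁₂x₂)} dx₁ ≤ C · ∫ F₁ e^{−(x₁ᵀS₁₁x₁ + 2x₁ᵀS₁₂x₂)} dx₁` — then the whole numerator is at most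
`C` times the whole denominator: the far characteristic function `F₂` and the far self-coupling `S₂₂` DO NOT ENTER (they multiply both
fibre integrals by the same non-negative factor `F₂(x₂)e^{−x₂ᵀS₂₂x₂}`).  Integrability of the two full integrands is displayed. [folklore] -/
theorem restrictedMoment_le_of_shifted_fibres (S₁₁ Q₁ : Matrix n₁ n₁ ℝ) (S₁₂ : Matrix n₁ n₂ ℝ) (S₂₂ : Matrix n₂ n₂ ℝ)
    (F₁ : (n₁ → ℝ) → ℝ) (F₂ : (n₂ → ℝ) → ℝ) {C : ℝ} (hF₂ : ∀ x₂, 0 ≤ F₂ x₂)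
    (hA : Integrable fun x : n₁ ⊕ n₂ → ℝ => (F₁ (fun i => x (Sum.inl i)) * F₂ (fun i => x (Sum.inr i))) *
      (exp (x ⬝ᵥ (Matrix.fromBlocks Q₁ 0 0 (0 : Matrix n₂ n₂ ℝ) *ᵥ x)) *
        exp (-(x ⬝ᵥ (Matrix.fromBlocks S₁₁ S₁₂ S₁₂ᵀ S₂₂ *ᵥ x)))))
    (hB : Integrable fun x : n₁ ⊕ n₂ → ℝ => (F₁ (fun i => x (Sum.inl i)) * F₂ (fun i => x (Sum.inr i))) *
      exp (-(x ⬝ᵥ (Matrix.fromBlocks S₁₁ S₁₂ S₁₂ᵀ S₂₂ *ᵥ x))))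
    (hfib : ∀ x₂, F₂ x₂ ≠ 0 →
      ∫ x₁, F₁ x₁ * (exp (x₁ ⬝ᵥ (Q₁ *ᵥ x₁)) * exp (-(x₁ ⬝ᵥ (S₁₁ *ᵥ x₁) + 2 * (x₁ ⬝ᵥ (S₁₂ *ᵥ x₂))))) ≤
        C * ∫ x₁, F₁ x₁ * exp (-(x₁ ⬝ᵥ (S₁₁ *ᵥ x₁) + 2 * (x₁ ⬝ᵥ (S₁₂ *ᵥ x₂))))) :
    ∫ x : n₁ ⊕ n₂ → ℝ, (F₁ (fun i => x (Sum.inl i)) * F₂ (fun i => x (Sum.inr i))) *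
        (exp (x ⬝ᵥ (Matrix.fromBlocks Q₁ 0 0 (0 : Matrix n₂ n₂ ℝ) *ᵥ x)) *
          exp (-(x ⬝ᵥ (Matrix.fromBlocks S₁₁ S₁₂ S₁₂ᵀ S₂₂ *ᵥ x)))) ≤
      C * ∫ x : n₁ ⊕ n₂ → ℝ, (F₁ (fun i => x (Sum.inl i)) * F₂ (fun i => x (Sum.inr i))) *
        exp (-(x ⬝ᵥ (Matrix.fromBlocks S₁₁ S₁₂ S₁₂ᵀ S₂₂ *ᵥ x))) := by
  refine integral_le_of_fibrewise_sum hA hB fun x₂ => ?_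
  have h1 : ∀ x₁ : n₁ → ℝ, (fun i => Sum.elim x₁ x₂ (Sum.inl i)) = x₁ := fun _ => rfl
  have h2 : ∀ x₁ : n₁ → ℝ, (fun i => Sum.elim x₁ x₂ (Sum.inr i)) = x₂ := fun _ => rfl
  have eA : ∀ x₁ : n₁ → ℝ,
      (F₁ (fun i => Sum.elim x₁ x₂ (Sum.inl i)) * F₂ (fun i => Sum.elim x₁ x₂ (Sum.inr i))) *
        (exp (Sum.elim x₁ x₂ ⬝ᵥ (Matrix.fromBlocks Q₁ 0 0 (0 : Matrix n₂ n₂ ℝ) *ᵥ Sum.elim x₁ x₂)) *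
          exp (-(Sum.elim x₁ x₂ ⬝ᵥ (Matrix.fromBlocks S₁₁ S₁₂ S₁₂ᵀ S₂₂ *ᵥ Sum.elim x₁ x₂)))) =
      (F₂ x₂ * exp (-(x₂ ⬝ᵥ (S₂₂ *ᵥ x₂)))) *
        (F₁ x₁ * (exp (x₁ ⬝ᵥ (Q₁ *ᵥ x₁)) * exp (-(x₁ ⬝ᵥ (S₁₁ *ᵥ x₁) + 2 * (x₁ ⬝ᵥ (S₁₂ *ᵥ x₂)))))) := by
    intro x₁
    rw [qf_fromBlocks_near, h1, h2, qf_fromBlocks_coupled, neg_add, exp_add]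
    ring
  have eB : ∀ x₁ : n₁ → ℝ,
      (F₁ (fun i => Sum.elim x₁ x₂ (Sum.inl i)) * F₂ (fun i => Sum.elim x₁ x₂ (Sum.inr i))) *
        exp (-(Sum.elim x₁ x₂ ⬝ᵥ (Matrix.fromBlocks S₁₁ S₁₂ S₁₂ᵀ S₂₂ *ᵥ Sum.elim x₁ x₂))) =
      (F₂ x₂ * exp (-(x₂ ⬝ᵥ (S₂₂ *ᵥ x₂)))) *
        (F₁ x₁ * exp (-(x₁ ⬝ᵥ (S₁₁ *ᵥ x₁) + 2 * (x₁ ⬝ᵥ (S₁₂ *ᵥ x₂))))) := by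
    intro x₁
    rw [h1, h2, qf_fromBlocks_coupled, neg_add, exp_add]
    ring
  simp_rw [eA, eB, integral_const_mul]
  by_cases h0 : F₂ x₂ = 0
  · rw [h0, zero_mul, zero_mul, zero_mul, mul_zero]
  · have hc : 0 ≤ F₂ x₂ * exp (-(x₂ ⬝ᵥ (S₂₂ *ᵥ x₂))) := mul_nonneg (hF₂ x₂) (exp_pos _).le
    calc F₂ x₂ * exp (-(x₂ ⬝ᵥ (S₂₂ *ᵥ x₂))) *
          ∫ x₁, F₁ x₁ * (exp (x₁ ⬝ᵥ (Q₁ *ᵥ x₁)) * exp (-(x₁ ⬝ᵥ (S₁₁ *ᵥ x₁) + 2 * (x₁ ⬝ᵥ (S₁₂ *ᵥ x₂)))))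
        ≤ F₂ x₂ * exp (-(x₂ ⬝ᵥ (S₂₂ *ᵥ x₂))) *
          (C * ∫ x₁, F₁ x₁ * exp (-(x₁ ⬝ᵥ (S₁₁ *ᵥ x₁) + 2 * (x₁ ⬝ᵥ (S₁₂ *ᵥ x₂))))) :=
          mul_le_mul_of_nonneg_left (hfib x₂ h0) hc
      _ = C * (F₂ x₂ * exp (-(x₂ ⬝ᵥ (S₂₂ *ᵥ x₂))) *
          ∫ x₁, F₁ x₁ * exp (-(x₁ ⬝ᵥ (S₁₁ *ᵥ x₁) + 2 * (x₁ ⬝ᵥ (S₁₂ *ᵥ x₂))))) := by ring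

end Summit.QuantumFields.BalabanUV.T4Continuum.NE7b.GaussianFibrewiseDecoupling
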